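import Summits.AtomisticToContinuum.Crystallization.Theorems.OverbindingBudgetAffineBarlowSum

/-!
# OverbindingBudget — admissibility of a chart from twelve comparisons, over the Literature's Barlow shell
# (decomp-a2c lens-4, generation 46/48; S support completing the finite reduction of `ChartAdmissible` for Zr‴a `ShelteredFarCharting` and the P5 inhabitant)

Imports ONLY `…Theorems.OverbindingBudgetAffineBarlowSum`.  The twelve-neighbour shell of a Hägg-coded Barlow stacking is ALREADY formalised in the
Literature — `Literature/MathematicalPhysics/StatisticalMechanics/BarlowCoordination.lean` (Hales, *Dense Sphere Packings* §1.3; Conway–Sloane Ch. 4):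
`sixOffsets`, `threeOffsets σ`, `dist_barlowPos_eq_iff`, `touching_eq_union`, `ncard_touching_eq_twelve` — and is NOT re-defined here (review 2026-09-01,
replacing generation 46's private index lists).  PROVED, 0 sorry, no new definitions:
* `norm_barlowPos_eq_one_iff` — the centre instance of `dist_barlowPos_eq_iff`: `‖barlowPos 1 √(2/3) s L a b‖ = 1` iff `(L, −a, −b)` is one of the six
  in-layer offsets, or one of the three offsets `threeOffsets (−s 0)` in layer `1`, or one of the three offsets `threeOffsets (s (−1))` in layer `−1`;
* ★ `chartAdmissible_of_twelve` — the admissibility constructor `chartAdmissible_of_first_shell` with its first-shell minimisation hypothesis restricted to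
  those twelve index triples (a finite check; used chart by chart by the Zr‴a prover and by the P5 inhabitant).
-/

namespace Summit.AtomisticToContinuum.Crystallization.Theorems.OverbindingBudgetAffineFarSmoothSplit

open scoped BigOperators Classical
open Literature.MathematicalPhysics.StatisticalMechanics

local notation "E3" => EuclideanSpace ℝ (Fin 3)

/-- **The first shell at the centre, from the Literature's `dist_barlowPos_eq_iff`**: a structure point `barlowPos 1 √(2/3) s L a b` has norm `1` iff its
index is one of the twelve neighbours of the origin `barlowPos … 0 0 0 = 0` (offsets `(0 − a, 0 − b)`). (tree lemma `BarlowCoordination.dist_barlowPos_eq_iff`) -/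
theorem norm_barlowPos_eq_one_iff {s : ℤ → ℤ} (hs : IsHaggSeq s) (L a b : ℤ) :
    ‖barlowPos 1 (Real.sqrt (2 / 3)) s L a b‖ = 1 ↔
      (L = 0 ∧ (-a, -b) ∈ sixOffsets) ∨ (L = 1 ∧ (-a, -b) ∈ threeOffsets (-s 0)) ∨ (L = -1 ∧ (-a, -b) ∈ threeOffsets (s (-1))) := by
  have hh : Real.sqrt (2 / 3) ^ 2 = 2 / 3 * (1 : ℝ) ^ 2 := by rw [Real.sq_sqrt (by norm_num)]; norm_num
  have h := dist_barlowPos_eq_iff hs one_pos hh 0 0 0 L a b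
  rw [barlowPos_zero_zero_zero, dist_eq_norm, zero_sub, norm_neg] at h
  simpa using h

/-- ★ **Admissibility from twelve comparisons**: as `chartAdmissible_of_first_shell`, with the first-shell minimisation of `‖B ·‖` checked only on the
twelve index triples of the Literature shell (`sixOffsets` in layer `0`, `threeOffsets (−s 0)` in layer `1`, `threeOffsets (s (−1))` in layer `−1`). [this file] -/
theorem chartAdmissible_of_twelve {θ m : ℝ} (hθ : m ≤ 3 * θ) (hm : m ≤ 1 / 6) {s : ℤ → ℤ} (hs : IsHaggSeq s)
    {B : E3 →ₗ[ℝ] E3} (hB : ∃ Q : E3 →ₗᵢ[ℝ] E3, ∀ v, ‖B v - Q v‖ ≤ m * ‖v‖) {a₀ : ℝ} (ha : 0 < a₀) {w₁ : E3}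
    (hw₁ : w₁ ∈ barlowStacking 1 (Real.sqrt (2 / 3)) s) (h₁ : ‖w₁‖ = 1)
    (hmin : ∀ L a b : ℤ,
      (L = 0 ∧ (-a, -b) ∈ sixOffsets) ∨ (L = 1 ∧ (-a, -b) ∈ threeOffsets (-s 0)) ∨ (L = -1 ∧ (-a, -b) ∈ threeOffsets (s (-1))) →
        ‖B w₁‖ ≤ ‖B (barlowPos 1 (Real.sqrt (2 / 3)) s L a b)‖) :
    ChartAdmissible θ ⟨s, B, a₀, a₀ * ‖B w₁‖⟩ := by
  refine chartAdmissible_of_first_shell hθ hm hs hB ha hw₁ h₁ fun p hp hp1 => ?_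
  obtain ⟨L, a, b, rfl⟩ := hp
  exact hmin L a b ((norm_barlowPos_eq_one_iff hs L a b).1 hp1)

end Summit.AtomisticToContinuum.Crystallization.Theorems.OverbindingBudgetAffineFarSmoothSplit
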